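import Literature.AlgebraicGeometry.Surfaces.K3SurfaceProofs
import Literature.AlgebraicGeometry.Surfaces.K3TwistorLines
import Mathlib.LinearAlgebra.BilinearForm.Properties
import Mathlib.LinearAlgebra.Dual.Lemmas

/-!
# Crux `NikulinSerreCarrier`, line `neron-severi-intertwiner`, stub S4 (`stub_blockCriterion`):
# the linear-algebra heart of the Hodge block criterion

Two kernel-checked lemmas with NO named-fact dependence, used by the conditional core
`blockCriterion_core_of_facts` (sibling file
`NikulinTwinTransportNikulinSerreCarrierBlockCriterion`):

* `ratLinearMap_eq_zero_of_irreducible` (registered as `stub_blockCriterionDescent`) — **descent /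
  irreducibility** (Huybrechts, *Lectures on K3 Surfaces*, Ch. 3 Lemma 3.1 in the form used):
  over `ℚ ⊂ ℂ`, `B` a non-degenerate bilinear form on `ℚ^ι` with complexification `B_ℂ`,
  `L : ℂ^ι → ℂ^{ι'}` a `ℂ`-linear map DEFINED OVER `ℚ`; if the only rational `k` with `B_ℂ(k, z) = 0`
  for every `z ∈ ker L` is `k = 0`, then `L = 0` (test `g ∘ ℓ = B(k_g, ·)` for every rational `g`).
* `k3Rat_eq_zero_of_period` (registered as `stub_blockCriterionHodgeIndex`) — **Hodge index on the
  K3 lattice** (signature `(3, 19)`, Huybrechts Ch. 14 §0.3 (vi); Ch. 6 Prop. 1.5): for a projective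
  period point `x ∈ Λ_ℂ` and a lattice vector `u ∈ x^⊥` with `(u.u) > 0`, a rational `k` with
  `(k.x) = (k.u) = (k.k) = 0` is zero: `⟨u, Re x, Im x⟩` is a positive three-space and its real
  orthogonal is negative definite, because `Λ_ℝ` contains the explicit negative definite `19`-space
  `E₈(−1)^{⊕2} ⊕ ⟨eₖ − fₖ⟩` of codimension `3`.
-/

noncomputable section

set_option linter.dupNamespace false

namespace Summit.HodgeConjecture.HodgeConjecture.Theorems.NikulinSerreCarrier.NeronSeveriIntertwiner

open Literature.AlgebraicGeometry.Surfaces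

section Descent

variable {ι ι' : Type*} [Fintype ι] [Fintype ι'] [DecidableEq ι] [DecidableEq ι']

/-- The standard basis vector `e_j ∈ ℂ^ι` is the rational vector `e_j ∈ ℚ^ι`. [folklore] -/
theorem basisFun_eq_ratCast (j : ι) :
    (Pi.basisFun ℂ ι) j = fun i => ((Pi.basisFun ℚ ι j : ι → ℚ) i : ℂ) := by
  funext i
  by_cases h : i = j
  · subst h; simp
  · simp [h]

/-- **Descent / irreducibility lemma.** `B` a non-degenerate bilinear form on `ℚ^ι`, `Bc` a
`ℂ`-bilinear form on `ℂ^ι` extending it on rational vectors, `L : ℂ^ι → ℂ^{ι'}` a `ℂ`-linear map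
restricting to the `ℚ`-linear `ℓ` on `ℚ^ι`. If every rational `k` with `Bc(k, z) = 0` for all
`z ∈ ker L` vanishes, then `L = 0`. (Huybrechts, *Lectures on K3 Surfaces*, Ch. 3, proof of
Lemma 3.1: a sub-Hodge structure of `T` whose complexification contains `σ` has trivial rational
orthogonal, hence is everything — here with `ker L` in place of the sub-Hodge structure.)
[cite: Huybrechts2016K3, Ch. 3 Lemma 3.1] -/
theorem ratLinearMap_eq_zero_of_irreducible
    (B : LinearMap.BilinForm ℚ (ι → ℚ)) (hB : B.Nondegenerate)
    (Bc : LinearMap.BilinForm ℂ (ι → ℂ))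
    (hBc : ∀ u v : ι → ℚ, Bc (fun i => (u i : ℂ)) (fun i => (v i : ℂ)) = ((B u v : ℚ) : ℂ))
    (ℓ : (ι → ℚ) →ₗ[ℚ] (ι' → ℚ)) (L : (ι → ℂ) →ₗ[ℂ] (ι' → ℂ))
    (hL : ∀ u : ι → ℚ, L (fun i => (u i : ℂ)) = fun i => (ℓ u i : ℂ))
    (hirr : ∀ k : ι → ℚ, (∀ z, L z = 0 → Bc (fun i => (k i : ℂ)) z = 0) → k = 0) : L = 0 := by
  classical
  have hℓ : ∀ u, ℓ u = 0 := by
    intro u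
    refine (Module.forall_dual_apply_eq_zero_iff ℚ (ℓ u)).1 fun g => ?_
    set k : ι → ℚ := (B.toDual hB).symm (g ∘ₗ ℓ) with hk
    have hkB : ∀ v, B k v = g (ℓ v) := fun v => by
      rw [hk, LinearMap.BilinForm.apply_toDual_symm_apply]; rfl
    let gc : (ι' → ℂ) →ₗ[ℂ] ℂ :=
      ∑ i, ((g (fun j => if i = j then 1 else 0) : ℚ) : ℂ) • LinearMap.proj i
    have hgc : ∀ w : ι' → ℚ, gc (fun i => (w i : ℂ)) = ((g w : ℚ) : ℂ) := by
      intro w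
      rw [LinearMap.pi_apply_eq_sum_univ g w]
      simp only [gc, LinearMap.coe_sum, Finset.sum_apply, LinearMap.smul_apply,
        LinearMap.proj_apply, smul_eq_mul, Rat.cast_sum, Rat.cast_mul]
      exact Finset.sum_congr rfl fun i _ => mul_comm _ _
    -- `Bc(k, z) = gc (L z)` for every complex `z` (both sides are `ℂ`-linear; check on `e_j`)
    have hkz : Bc (fun i => (k i : ℂ)) = gc ∘ₗ L := by
      refine (Pi.basisFun ℂ ι).ext fun j => ?_
      rw [basisFun_eq_ratCast, LinearMap.comp_apply, hBc, hL, hgc, hkB]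
    have hk0 : k = 0 := hirr k fun z hz => by rw [hkz, LinearMap.comp_apply, hz, map_zero]
    rw [← hkB u, hk0]
    exact LinearMap.BilinForm.zero_left u
  refine (Pi.basisFun ℂ ι).ext fun j => ?_
  rw [basisFun_eq_ratCast, hL, hℓ, LinearMap.zero_apply]
  funext i
  simp only [Pi.zero_apply, Rat.cast_zero]

end Descent

section K3Real

/-- **Lagrange completion of squares for `E₈` over `ℝ`** (verbatim the integral identity
`CartanMatrix_E₈_sixty_mul_quadratic`). [cite: Huybrechts2016K3, Ch. 14 §0.3 (iii)] -/
theorem E8_real_sixty_mul_quadratic (v : Fin 8 → ℝ) :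
    60 * ∑ i, ∑ j, v i * (CartanMatrix.E₈ i j : ℝ) * v j =
      30 * (2 * v 0 - v 2) ^ 2 + 30 * (2 * v 1 - v 3) ^ 2 + 10 * (3 * v 2 - 2 * v 3) ^ 2 +
      2 * (5 * v 3 - 6 * v 4) ^ 2 + 3 * (4 * v 4 - 5 * v 5) ^ 2 + 5 * (3 * v 5 - 4 * v 6) ^ 2 +
      10 * (2 * v 6 - 3 * v 7) ^ 2 + 30 * v 7 ^ 2 := by
  simp [Fin.sum_univ_eight, CartanMatrix.E₈]
  ring

/-- `E₈` is positive semi-definite on `ℝ⁸`. [cite: Huybrechts2016K3, Ch. 14 §0.3 (iii)] -/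
theorem E8_real_quadratic_nonneg (v : Fin 8 → ℝ) :
    0 ≤ ∑ i, ∑ j, v i * (CartanMatrix.E₈ i j : ℝ) * v j := by
  have h60 := E8_real_sixty_mul_quadratic v
  nlinarith [sq_nonneg (2 * v 0 - v 2), sq_nonneg (2 * v 1 - v 3), sq_nonneg (3 * v 2 - 2 * v 3),
    sq_nonneg (5 * v 3 - 6 * v 4), sq_nonneg (4 * v 4 - 5 * v 5), sq_nonneg (3 * v 5 - 4 * v 6),
    sq_nonneg (2 * v 6 - 3 * v 7), sq_nonneg (v 7)]

/-- `E₈` is anisotropic on `ℝ⁸`: `vᵀ E₈ v = 0` forces `v = 0`.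
[cite: Huybrechts2016K3, Ch. 14 §0.3 (iii)] -/
theorem E8_real_quadratic_eq_zero {v : Fin 8 → ℝ}
    (h : ∑ i, ∑ j, v i * (CartanMatrix.E₈ i j : ℝ) * v j = 0) : v = 0 := by
  have h60 := E8_real_sixty_mul_quadratic v
  rw [h, mul_zero] at h60
  have s0 := sq_nonneg (2 * v 0 - v 2); have s1 := sq_nonneg (2 * v 1 - v 3)
  have s2 := sq_nonneg (3 * v 2 - 2 * v 3); have s3 := sq_nonneg (5 * v 3 - 6 * v 4)
  have s4 := sq_nonneg (4 * v 4 - 5 * v 5); have s5 := sq_nonneg (3 * v 5 - 4 * v 6)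
  have s6 := sq_nonneg (2 * v 6 - 3 * v 7); have s7 := sq_nonneg (v 7)
  have aux : ∀ t : ℝ, t ^ 2 = 0 → t = 0 := fun t ht =>
    pow_eq_zero_iff (n := 2) (by norm_num) |>.1 ht
  have h7 : v 7 = 0 := aux _ (by linarith)
  have h6 : v 6 = 0 := by have := aux (2 * v 6 - 3 * v 7) (by linarith); linarith
  have h5 : v 5 = 0 := by have := aux (3 * v 5 - 4 * v 6) (by linarith); linarith
  have h4 : v 4 = 0 := by have := aux (4 * v 4 - 5 * v 5) (by linarith); linarith
  have h3 : v 3 = 0 := by have := aux (5 * v 3 - 6 * v 4) (by linarith); linarith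
  have h2 : v 2 = 0 := by have := aux (3 * v 2 - 2 * v 3) (by linarith); linarith
  have h1 : v 1 = 0 := by have := aux (2 * v 1 - v 3) (by linarith); linarith
  have h0 : v 0 = 0 := by have := aux (2 * v 0 - v 2) (by linarith); linarith
  funext i
  fin_cases i <;> simp [h0, h1, h2, h3, h4, h5, h6, h7]

/-- **Block decomposition of the real K3 quadratic form** in the coordinates of
`Λ = E₈(−1) ⊕ E₈(−1) ⊕ U ⊕ U ⊕ U` (the real form of `k3Lattice_quadratic_eq`).
[cite: Huybrechts2016K3, Ch. 14 §0.3 (vi)] -/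
theorem k3Real_quadratic_eq (v : K3Index → ℝ) :
    ∑ i, ∑ j, v i * (k3Gram i j : ℝ) * v j =
      -(∑ i, ∑ j, v (Sum.inl (Sum.inl i)) * (CartanMatrix.E₈ i j : ℝ) * v (Sum.inl (Sum.inl j)))
      - (∑ i, ∑ j, v (Sum.inl (Sum.inr i)) * (CartanMatrix.E₈ i j : ℝ) * v (Sum.inl (Sum.inr j)))
      + 2 * (v (Sum.inr (Sum.inl 0)) * v (Sum.inr (Sum.inl 1))
          + v (Sum.inr (Sum.inr (Sum.inl 0))) * v (Sum.inr (Sum.inr (Sum.inl 1)))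
          + v (Sum.inr (Sum.inr (Sum.inr 0))) * v (Sum.inr (Sum.inr (Sum.inr 1)))) := by
  simp only [k3Gram, hyperbolicPlaneGram, Fintype.sum_sum_type, Matrix.fromBlocks_apply₁₁,
    Matrix.fromBlocks_apply₁₂, Matrix.fromBlocks_apply₂₁, Matrix.fromBlocks_apply₂₂,
    Matrix.zero_apply, Matrix.neg_apply, Int.cast_zero, Int.cast_neg, mul_zero, zero_mul,
    Finset.sum_const_zero, add_zero, zero_add, mul_neg, neg_mul, Finset.sum_neg_distrib,
    Fin.sum_univ_two, Matrix.of_apply, Matrix.cons_val', Matrix.cons_val_zero, Matrix.cons_val_one,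
    Matrix.empty_val', Matrix.cons_val_fin_one, Int.cast_one]
  ring

/-- **The negative `19`-space of `Λ_ℝ`**: the real K3 form is negative definite on the real span
of `E₈(−1)^{⊕2} ⊕ ⟨e₁ − f₁, e₂ − f₂, e₃ − f₃⟩` (vectors with `bₖ = −aₖ` on the hyperbolic planes),
the real form of `k3Lattice_neg_of_antidiag`. [cite: Huybrechts2016K3, Ch. 14 §0.3 (vi)] -/
theorem k3Real_neg_of_antidiag {v : K3Index → ℝ}
    (h1 : v (Sum.inr (Sum.inl 1)) = -v (Sum.inr (Sum.inl 0)))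
    (h2 : v (Sum.inr (Sum.inr (Sum.inl 1))) = -v (Sum.inr (Sum.inr (Sum.inl 0))))
    (h3 : v (Sum.inr (Sum.inr (Sum.inr 1))) = -v (Sum.inr (Sum.inr (Sum.inr 0))))
    (hv : v ≠ 0) :
    ∑ i, ∑ j, v i * (k3Gram i j : ℝ) * v j < 0 := by
  -- adapted from `Literature.AlgebraicGeometry.Surfaces.k3Lattice_neg_of_antidiag`
  rw [k3Real_quadratic_eq, h1, h2, h3]
  have q1 := E8_real_quadratic_nonneg (fun i => v (Sum.inl (Sum.inl i)))
  have q2 := E8_real_quadratic_nonneg (fun i => v (Sum.inl (Sum.inr i)))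
  have a1 := sq_nonneg (v (Sum.inr (Sum.inl 0)))
  have a2 := sq_nonneg (v (Sum.inr (Sum.inr (Sum.inl 0))))
  have a3 := sq_nonneg (v (Sum.inr (Sum.inr (Sum.inr 0))))
  by_contra hge
  have hge := not_lt.mp hge
  apply hv
  have e1 : ∑ i, ∑ j,
      v (Sum.inl (Sum.inl i)) * (CartanMatrix.E₈ i j : ℝ) * v (Sum.inl (Sum.inl j)) = 0 := by
    nlinarith
  have e2 : ∑ i, ∑ j,
      v (Sum.inl (Sum.inr i)) * (CartanMatrix.E₈ i j : ℝ) * v (Sum.inl (Sum.inr j)) = 0 := by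
    nlinarith
  have z1 : v (Sum.inr (Sum.inl 0)) = 0 := by nlinarith
  have z2 : v (Sum.inr (Sum.inr (Sum.inl 0))) = 0 := by nlinarith
  have z3 : v (Sum.inr (Sum.inr (Sum.inr 0))) = 0 := by nlinarith
  have w1 := E8_real_quadratic_eq_zero e1
  have w2 := E8_real_quadratic_eq_zero e2
  funext i
  rcases i with (i | i) | (i | (i | i))
  · exact congrFun w1 i
  · exact congrFun w2 i
  · fin_cases i; exacts [z1, by simp [h1, z1]]
  · fin_cases i; exacts [z2, by simp [h2, z2]]
  · fin_cases i; exacts [z3, by simp [h3, z3]]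

/-- **Index bound `n₊(Λ_{K3}) ≤ 3` in the form used**: if `(t₀, t₁, t₂)` spans a positive definite
three-space of `Λ_ℝ` and `w` is orthogonal to it with `(w.w) ≥ 0`, then `w = 0`. Otherwise
`⟨t₀, t₁, t₂, w⟩` is a positive semi-definite `4`-space, which must meet the negative definite
`19`-space of `k3Real_neg_of_antidiag` (cut out by `3` linear equations) non-trivially. Stated for
`B` the real K3 form `Matrix.toBilin' (k3Gram.map Int.cast)` (hypothesis `hB`, as in
`K3TwistorLines`). [cite: Huybrechts2016K3, Ch. 14 §0.3 (vi) (signature `(3, 19)`)] -/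
theorem k3Real_eq_zero_of_perp_posThree {B : LinearMap.BilinForm ℝ (K3Index → ℝ)}
    (hB : B = Matrix.toBilin' (k3Gram.map (Int.cast : ℤ → ℝ))) (t : Fin 3 → K3Index → ℝ)
    (ht : ∀ c : Fin 3 → ℝ, c ≠ 0 → 0 < B (∑ i, c i • t i) (∑ i, c i • t i))
    {w : K3Index → ℝ} (hw : ∀ i, B (t i) w = 0) (hww : 0 ≤ B w w) : w = 0 := by
  classical
  have hBs : ∀ u v, B u v = B v u := fun u v => by rw [hB]; exact k3RForm_comm u v
  have hBa : ∀ u v, B u v = ∑ i, ∑ j, u i * (k3Gram i j : ℝ) * v j := fun u v => by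
    rw [hB]; exact k3RForm_apply u v
  by_contra hw0
  have hpw : ∀ c : Fin 3 → ℝ, B (∑ i, c i • t i) w = 0 := fun c => by
    rw [twistorChain_sum_smul_left]
    simp [hw]
  -- the family `s = (t₀, t₁, t₂, w)`
  let s : Fin 4 → K3Index → ℝ := ![t 0, t 1, t 2, w]
  have hsum : ∀ g : Fin 4 → ℝ,
      ∑ i, g i • s i = (∑ i, (![g 0, g 1, g 2] : Fin 3 → ℝ) i • t i) + g 3 • w := by
    intro g
    simp only [s, Fin.sum_univ_four, Fin.sum_univ_three, Matrix.cons_val_zero, Matrix.cons_val_one,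
      Matrix.cons_val_two, Matrix.cons_val]
    rfl
  -- `s` is linearly independent
  have hlin : LinearIndependent ℝ s := by
    rw [Fintype.linearIndependent_iff]
    intro g hg
    set c : Fin 3 → ℝ := ![g 0, g 1, g 2] with hc
    rw [hsum] at hg
    have hp : ∑ i, c i • t i = -(g 3 • w) := eq_neg_of_add_eq_zero_left hg
    have hBpp : B (∑ i, c i • t i) (∑ i, c i • t i) = 0 := by
      conv_lhs => arg 2; rw [hp]
      rw [LinearMap.BilinForm.neg_right, LinearMap.BilinForm.smul_right, hpw, mul_zero, neg_zero]
    have hc0 : c = 0 := by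
      by_contra hc0
      exact (ht c hc0).ne' hBpp
    have hp0 : ∑ i, c i • t i = 0 := by rw [hc0]; simp
    rw [hp0, zero_eq_neg, smul_eq_zero] at hp
    intro i
    fin_cases i
    exacts [by simpa [hc] using congrFun hc0 0, by simpa [hc] using congrFun hc0 1,
      by simpa [hc] using congrFun hc0 2, hp.resolve_right hw0]
  -- the three linear forms `aₖ + bₖ` cutting out the negative `19`-space
  let P : K3Index → ((K3Index → ℝ) →ₗ[ℝ] ℝ) := fun i =>
    LinearMap.proj (R := ℝ) (φ := fun _ : K3Index => ℝ) i
  let F : Fin 3 → ((K3Index → ℝ) →ₗ[ℝ] ℝ) :=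
    ![P (Sum.inr (Sum.inl 0)) + P (Sum.inr (Sum.inl 1)),
      P (Sum.inr (Sum.inr (Sum.inl 0))) + P (Sum.inr (Sum.inr (Sum.inl 1))),
      P (Sum.inr (Sum.inr (Sum.inr 0))) + P (Sum.inr (Sum.inr (Sum.inr 1)))]
  let f : (K3Index → ℝ) →ₗ[ℝ] (Fin 3 → ℝ) := LinearMap.pi F
  have hdep : ¬ LinearIndependent ℝ (f ∘ s) := fun h => by
    have h4 := h.fintype_card_le_finrank
    simp [Module.finrank_fintype_fun_eq_card] at h4
  obtain ⟨g, hg, i₀, hi₀⟩ := Fintype.not_linearIndependent_iff.1 hdep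
  set q : K3Index → ℝ := ∑ i, g i • s i with hq
  have hq0 : q ≠ 0 := fun h => hi₀ (Fintype.linearIndependent_iff.1 hlin g h i₀)
  have hfq : f q = 0 := by
    rw [hq, map_sum]
    simpa only [Function.comp_apply, map_smul] using hg
  have e1 : q (Sum.inr (Sum.inl 0)) + q (Sum.inr (Sum.inl 1)) = 0 := by
    simpa [f, F, P] using congrFun hfq 0
  have e2 : q (Sum.inr (Sum.inr (Sum.inl 0))) + q (Sum.inr (Sum.inr (Sum.inl 1))) = 0 := by
    simpa [f, F, P] using congrFun hfq 1
  have e3 : q (Sum.inr (Sum.inr (Sum.inr 0))) + q (Sum.inr (Sum.inr (Sum.inr 1))) = 0 := by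
    simpa [f, F, P] using congrFun hfq 2
  -- `(q.q) ≥ 0` since `q = p + g₃ w` with `p` in the positive three-space and `p ⊥ w`
  have hqq : 0 ≤ B q q := by
    rw [hq, hsum g]
    set c : Fin 3 → ℝ := ![g 0, g 1, g 2] with hc
    have hwp : B w (∑ i, c i • t i) = 0 := by rw [hBs, hpw]
    have hexp : B ((∑ i, c i • t i) + g 3 • w) ((∑ i, c i • t i) + g 3 • w) =
        B (∑ i, c i • t i) (∑ i, c i • t i) + g 3 * g 3 * B w w := by
      simp only [LinearMap.BilinForm.add_left, LinearMap.BilinForm.add_right,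
        LinearMap.BilinForm.smul_left, LinearMap.BilinForm.smul_right, hpw, hwp]
      ring
    rw [hexp]
    have hBpp : 0 ≤ B (∑ i, c i • t i) (∑ i, c i • t i) := by
      by_cases hc0 : c = 0
      · rw [hc0]; simp
      · exact (ht c hc0).le
    exact add_nonneg hBpp (mul_nonneg (mul_self_nonneg _) hww)
  -- `(q.q) < 0` since `q ≠ 0` lies in the negative `19`-space
  have hneg := k3Real_neg_of_antidiag (v := q) (eq_neg_of_add_eq_zero_right e1)
    (eq_neg_of_add_eq_zero_right e2) (eq_neg_of_add_eq_zero_right e3) hq0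
  rw [← hBa] at hneg
  exact absurd hqq (not_le.2 hneg)

/-- The real K3 form on rational vectors is the rational K3 form. [folklore] -/
theorem k3RForm_ratCast (a b : K3Index → ℚ) :
    Matrix.toBilin' (k3Gram.map (Int.cast : ℤ → ℝ)) (fun i => (a i : ℝ)) (fun i => (b i : ℝ)) =
      ((k3FormRat a b : ℚ) : ℝ) := by
  rw [k3RForm_apply, k3FormRat_apply]
  push_cast
  rfl

/-- A real vector orthogonal to `x ∈ Λ_ℂ` is orthogonal to `Re x` and `Im x` (real and imaginary
parts; the real form of `k3Period_intCast_orthogonal`). [cite: Huybrechts2016K3, Ch. 6 §1.1] -/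
theorem k3Real_orthogonal_re_im {x : K3Index → ℂ} {w : K3Index → ℝ}
    (hwx : k3Form (fun i => ((w i : ℝ) : ℂ)) x = 0) :
    Matrix.toBilin' (k3Gram.map (Int.cast : ℤ → ℝ)) w (fun j => (x j).re) = 0 ∧
      Matrix.toBilin' (k3Gram.map (Int.cast : ℤ → ℝ)) w (fun j => (x j).im) = 0 := by
  -- adapted from `Literature.AlgebraicGeometry.Surfaces.k3Period_intCast_orthogonal`
  set a : K3Index → ℂ := fun i => ((x i).re : ℂ) with ha
  set b : K3Index → ℂ := fun i => ((x i).im : ℂ) with hb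
  have hx : x = a + Complex.I • b := by
    funext i
    apply Complex.ext <;> simp [a, b]
  rw [hx, k3Form_add_right, k3Form_smul_right, ha, hb, k3Form_ofReal_eq_k3RForm,
    k3Form_ofReal_eq_k3RForm] at hwx
  have hre := congrArg Complex.re hwx; have him := congrArg Complex.im hwx
  simp at hre him
  exact ⟨hre, him⟩

/-- **Hodge index on the K3 lattice (the input of the block criterion).** For a projective
period point `x` (`(x.x) = 0`, `(x̄.x) > 0`), a lattice vector `u ∈ x^⊥` with `(u.u) > 0`, and a
RATIONAL vector `k` with `(k.x) = 0`, `(k.u) = 0`, `(k.k) = 0`: `k = 0`. For a marked projective K3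
surface with period `x` and ample class `u`: a rational class orthogonal to `σ`, to an ample class
and to itself vanishes — so the intersection form on `NS(Y)_ℚ` is non-degenerate (Hodge index)
and `NS ∩ T = 0`. Proof: `⟨u, Re x, Im x⟩` is a positive three-space
(`k3Period_positiveThreeSpace`), `k` is real and orthogonal to it, and `n₊(Λ) ≤ 3`
(`k3Real_eq_zero_of_perp_posThree`).
[cite: Huybrechts2016K3, Ch. 14 §0.3 (vi) and Ch. 6 Prop. 1.5; Ch. 1 §2.2 (Hodge index)] -/
theorem k3Rat_eq_zero_of_period {x : K3Index → ℂ} (hxx : k3Form x x = 0)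
    (hpos : 0 < (k3Form (star x) x).re) {u : K3Index → ℤ}
    (hux : k3Form (fun i => (u i : ℂ)) x = 0) (huu : 0 < ∑ i, ∑ j, u i * k3Gram i j * u j)
    {k : K3Index → ℚ} (hkx : k3Form (fun i => (k i : ℂ)) x = 0)
    (hku : k3FormRat k (fun i => (u i : ℚ)) = 0) (hkk : k3FormRat k k = 0) : k = 0 := by
  classical
  set B : LinearMap.BilinForm ℝ (K3Index → ℝ) := Matrix.toBilin' (k3Gram.map (Int.cast : ℤ → ℝ))
    with hB
  set w : K3Index → ℝ := fun i => (k i : ℝ) with hw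
  have hkC : (fun i => (k i : ℂ)) = fun i => ((w i : ℝ) : ℂ) := by
    funext i; simp [w]
  rw [hkC] at hkx
  obtain ⟨hre, him⟩ := k3Real_orthogonal_re_im hkx
  rw [← hB] at hre him
  -- the positive three-space `⟨u, Re x, Im x⟩`
  let t : Fin 3 → K3Index → ℝ := ![fun i => (u i : ℝ), fun j => (x j).re, fun j => (x j).im]
  have ht : ∀ c : Fin 3 → ℝ, c ≠ 0 → 0 < B (∑ i, c i • t i) (∑ i, c i • t i) := by
    intro c hc
    have hstu : (c 0, c 1, c 2) ≠ 0 := by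
      intro h0
      simp only [Prod.mk_eq_zero] at h0
      exact hc (funext fun i => by fin_cases i <;> simp [h0])
    have hcomb : ∑ i, c i • t i = fun j => c 0 * (u j : ℝ) + c 1 * (x j).re + c 2 * (x j).im := by
      funext j
      simp [t, Fin.sum_univ_three]
    rw [hcomb, hB, k3RForm_apply]
    exact k3Period_positiveThreeSpace hxx hpos hux huu hstu
  -- `w ⊥ u, Re x, Im x` and `(w.w) = 0`
  have hwu : B (fun i => (u i : ℝ)) w = 0 := by
    have h := k3RForm_ratCast (fun i => (u i : ℚ)) k
    rw [k3FormRat_isSymm.eq, hku, Rat.cast_zero, ← hB] at h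
    simpa using h
  have hBs : ∀ a b, B a b = B b a := fun a b => by rw [hB]; exact k3RForm_comm a b
  have hwt : ∀ i, B (t i) w = 0 := by
    intro i
    fin_cases i
    · exact hwu
    · simpa [t] using (by rw [hBs]; exact hre : B (fun j => (x j).re) w = 0)
    · simpa [t] using (by rw [hBs]; exact him : B (fun j => (x j).im) w = 0)
  have hww : 0 ≤ B w w := by
    have h := k3RForm_ratCast k k
    rw [hkk, Rat.cast_zero, ← hB] at h
    exact h.symm.le
  have hw0 := k3Real_eq_zero_of_perp_posThree hB t ht hwt hww
  funext i
  simpa [w] using congrFun hw0 i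

end K3Real

/-! ### Registered sub-goals of stub S4 (pure `∀` shape, the form registered on the crux item) -/

/-- **Registered sub-goal `stub_blockCriterionDescent` of S4**
(`ratLinearMap_eq_zero_of_irreducible` in `∀` form): a `ℂ`-linear map `ℂ^ι → ℂ^{ι'}` defined
over `ℚ` whose kernel is `B_ℂ`-total on rational vectors (`B` non-degenerate) is zero.
[cite: Huybrechts2016K3, Ch. 3 Lemma 3.1] -/
theorem stub_blockCriterionDescent :
    ∀ {ι ι' : Type} [Fintype ι] [Fintype ι'] [DecidableEq ι] [DecidableEq ι']
      (B : LinearMap.BilinForm ℚ (ι → ℚ)), B.Nondegenerate →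
      ∀ (Bc : LinearMap.BilinForm ℂ (ι → ℂ)),
        (∀ u v : ι → ℚ, Bc (fun i => (u i : ℂ)) (fun i => (v i : ℂ)) = ((B u v : ℚ) : ℂ)) →
        ∀ (ℓ : (ι → ℚ) →ₗ[ℚ] (ι' → ℚ)) (L : (ι → ℂ) →ₗ[ℂ] (ι' → ℂ)),
          (∀ u : ι → ℚ, L (fun i => (u i : ℂ)) = fun i => (ℓ u i : ℂ)) →
          (∀ k : ι → ℚ, (∀ z, L z = 0 → Bc (fun i => (k i : ℂ)) z = 0) → k = 0) → L = 0 :=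
  fun B hB Bc hBc ℓ L hL hirr => ratLinearMap_eq_zero_of_irreducible B hB Bc hBc ℓ L hL hirr

/-- **Registered sub-goal `stub_blockCriterionHodgeIndex` of S4** (= `k3Rat_eq_zero_of_period` in
`∀` form): Hodge index on the K3 lattice — a rational vector orthogonal to a projective period
point, to a positive lattice vector in its orthogonal, and to itself, vanishes.
[cite: Huybrechts2016K3, Ch. 14 §0.3 (vi); Ch. 1 §2.2 (Hodge index)] -/
theorem stub_blockCriterionHodgeIndex :
    ∀ (x : Literature.AlgebraicGeometry.Surfaces.K3Index → ℂ),
      Literature.AlgebraicGeometry.Surfaces.k3Form x x = 0 →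
      0 < (Literature.AlgebraicGeometry.Surfaces.k3Form (star x) x).re →
      ∀ (u : Literature.AlgebraicGeometry.Surfaces.K3Index → ℤ),
        Literature.AlgebraicGeometry.Surfaces.k3Form (fun i => (u i : ℂ)) x = 0 →
        0 < ∑ i, ∑ j, u i * Literature.AlgebraicGeometry.Surfaces.k3Gram i j * u j →
        ∀ (k : Literature.AlgebraicGeometry.Surfaces.K3Index → ℚ),
          Literature.AlgebraicGeometry.Surfaces.k3Form (fun i => (k i : ℂ)) x = 0 →
          Literature.AlgebraicGeometry.Surfaces.k3FormRat k (fun i => (u i : ℚ)) = 0 →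
          Literature.AlgebraicGeometry.Surfaces.k3FormRat k k = 0 → k = 0 :=
  fun _x hxx hpos _u hux huu _k hkx hku hkk => k3Rat_eq_zero_of_period hxx hpos hux huu hkx hku hkk

end Summit.HodgeConjecture.HodgeConjecture.Theorems.NikulinSerreCarrier.NeronSeveriIntertwiner

end
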